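import Mathlib
import Summits.Ventures.PercRepro2.Defs
import Summits.Ventures.PercRepro2.Independence
import Summits.Ventures.PercRepro2.Harris
import Summits.Ventures.PercRepro2.Graph
import Summits.Ventures.PercRepro2.Events
import Summits.Ventures.PercRepro2.BoxUnionDefs
import Summits.Ventures.PercRepro2.BoxUnion
import Summits.Ventures.PercRepro2.BoxUnionPair
import Summits.Ventures.PercRepro2.CondAvoidPA
import Summits.Ventures.PercRepro2.PairTP2

/-!
# (PAIR-TP2), the non-linkable half, in the kernel (blind cell PercRepro2, mine-1 g38;
proofs/MINE1-PAIRTP2.md §2, Case B)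

With the grid embedding of `PairTP2.lean`: the nine grid masses `M a b` are the probabilities
of the grid events `{code u = a, code v = b} ∩ {s ↮ t}`; the avoidance events of
`CondAvoidPA.pa_given_avoid_conn` are unions of grid events, so the two central minors of `M`
are exactly the positive-association inequalities of `pa_given_avoid_conn` (for `s`, and for
`t` with the roles exchanged); and if `(u, v)` is not linkable the two corner masses vanish.
Hence (`pairLaw_lsm_of_not_linkable`) the two-vertex status law is log-supermodular on the
(Z)-lattice, and (`hit_boxUnion_nonneg_of_not_linkable`) the union-row covariance inequality
holds for every `f, g` increasing in the `C_s`-status and decreasing in the `C_t`-status of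
`{u, v}`, on every such instance and for every weight vector.
-/

namespace Summit.Ventures.PercRepro2

namespace PairTP2

open Finset
open scoped Classical

variable {V : Type*} {E : Type*} [Fintype V] [DecidableEq V] [Fintype E] [DecidableEq E]
variable (ends : E → Sym2 V) (s t u v : V)

/-- The grid event `{code u = k.1, code v = k.2} ∩ {s ↮ t}`. -/
def gridEvent (k : Fin 3 × Fin 3) : Set (Config E) :=
  {ω | grid ends s t u v ω = k} ∩ (connEvent ends s t)ᶜ

omit [DecidableEq E] in
/-- Membership in a grid event. -/
lemma mem_gridEvent {k : Fin 3 × Fin 3} {ω : Config E} :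
    ω ∈ gridEvent ends s t u v k ↔
      code ends s t ω u = k.1 ∧ code ends s t ω v = k.2 ∧ ω ∈ (connEvent ends s t)ᶜ := by
  simp only [gridEvent, grid, Set.mem_inter_iff, Set.mem_setOf_eq, Prod.ext_iff]
  tauto

omit [DecidableEq E] in
/-- Distinct grid events are disjoint. -/
lemma gridEvent_disjoint {k k' : Fin 3 × Fin 3} (h : k ≠ k') :
    Disjoint (gridEvent ends s t u v k) (gridEvent ends s t u v k') := by
  rw [Set.disjoint_left]
  intro ω h1 h2
  exact h (h1.1.symm.trans h2.1)

omit [DecidableEq E] in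
/-- On `{s ↮ t}` the avoidance event `{t ↮ s, u, v}` is `{code u ≠ 0, code v ≠ 0}`. -/
lemma mem_avoid_iff {ω : Config E} (hQ : ω ∈ (connEvent ends s t)ᶜ) :
    ω ∈ CondAvoid.avoidEvent ends t {s, u, v} ↔
      code ends s t ω u ≠ 0 ∧ code ends s t ω v ≠ 0 := by
  have hts : ¬ Conn ends ω t s := fun h => hQ (conn_symm h)
  simp only [CondAvoid.avoidEvent, Set.mem_setOf_eq, Finset.mem_insert, Finset.mem_singleton,
    forall_eq_or_imp, forall_eq, hts, not_false_eq_true, true_and]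
  rw [← code_eq_zero_iff' hQ u, ← code_eq_zero_iff' hQ v]

omit [Fintype V] [Fintype E] [DecidableEq E] in
/-- The avoidance event lies in `{s ↮ t}`. -/
lemma avoid_subset : CondAvoid.avoidEvent ends t {s, u, v} ⊆ (connEvent ends s t)ᶜ := by
  intro ω h
  have := h s (by simp)
  exact fun h' => this (conn_symm h')

omit [DecidableEq E] in
/-- `{s ↔ x}` is `{code x = 2}`. -/
lemma mem_connEvent_iff_code {ω : Config E} (x : V) :
    ω ∈ connEvent ends s x ↔ code ends s t ω x = 2 := by
  rw [code_eq_two_iff]; rfl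

/-! ### The avoidance events as unions of grid events (the `s`-side) -/

omit [DecidableEq E] in
/-- `{u, v ∈ C_s} ∩ {t ↮ s, u, v}` is the grid event `(2, 2)`. -/
lemma ev_ss : connEvent ends s u ∩ connEvent ends s v ∩ CondAvoid.avoidEvent ends t {s, u, v} =
    gridEvent ends s t u v (2, 2) := by
  ext ω
  by_cases hQ : ω ∈ (connEvent ends s t)ᶜ
  · simp only [Set.mem_inter_iff, mem_connEvent_iff_code ends s t, mem_avoid_iff ends s t u v hQ,
      mem_gridEvent, hQ, and_true]
    generalize code ends s t ω u = a
    generalize code ends s t ω v = b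
    revert a b; decide
  · constructor
    · intro h; exact absurd (avoid_subset ends s t u v h.2) hQ
    · intro h; exact absurd h.2 hQ

omit [DecidableEq E] in
/-- `{u ∈ C_s} ∩ {t ↮ s, u, v}` is the union of the grid events `(2, 2)` and `(2, 1)`. -/
lemma ev_su : connEvent ends s u ∩ CondAvoid.avoidEvent ends t {s, u, v} =
    gridEvent ends s t u v (2, 2) ∪ gridEvent ends s t u v (2, 1) := by
  ext ω
  by_cases hQ : ω ∈ (connEvent ends s t)ᶜ
  · simp only [Set.mem_inter_iff, Set.mem_union, mem_connEvent_iff_code ends s t,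
      mem_avoid_iff ends s t u v hQ, mem_gridEvent, hQ, and_true]
    generalize code ends s t ω u = a
    generalize code ends s t ω v = b
    revert a b; decide
  · constructor
    · intro h; exact absurd (avoid_subset ends s t u v h.2) hQ
    · rintro (h | h) <;> exact absurd h.2 hQ

omit [DecidableEq E] in
/-- `{v ∈ C_s} ∩ {t ↮ s, u, v}` is the union of the grid events `(2, 2)` and `(1, 2)`. -/
lemma ev_sv : connEvent ends s v ∩ CondAvoid.avoidEvent ends t {s, u, v} =
    gridEvent ends s t u v (2, 2) ∪ gridEvent ends s t u v (1, 2) := by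
  ext ω
  by_cases hQ : ω ∈ (connEvent ends s t)ᶜ
  · simp only [Set.mem_inter_iff, Set.mem_union, mem_connEvent_iff_code ends s t,
      mem_avoid_iff ends s t u v hQ, mem_gridEvent, hQ, and_true]
    generalize code ends s t ω u = a
    generalize code ends s t ω v = b
    revert a b; decide
  · constructor
    · intro h; exact absurd (avoid_subset ends s t u v h.2) hQ
    · rintro (h | h) <;> exact absurd h.2 hQ

omit [DecidableEq E] in
/-- `{t ↮ s, u, v}` is the union of the four grid events with both codes in `{1, 2}`. -/
lemma ev_a : CondAvoid.avoidEvent ends t {s, u, v} =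
    ((gridEvent ends s t u v (2, 2) ∪ gridEvent ends s t u v (2, 1)) ∪
      gridEvent ends s t u v (1, 2)) ∪ gridEvent ends s t u v (1, 1) := by
  ext ω
  by_cases hQ : ω ∈ (connEvent ends s t)ᶜ
  · simp only [Set.mem_union, mem_avoid_iff ends s t u v hQ, mem_gridEvent, hQ, and_true]
    generalize code ends s t ω u = a
    generalize code ends s t ω v = b
    revert a b; decide
  · constructor
    · intro h; exact absurd (avoid_subset ends s t u v h) hQ
    · rintro (((h | h) | h) | h) <;> exact absurd h.2 hQ

/-! ### The `t`-side: the mirror events -/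

omit [DecidableEq E] in
/-- On `{s ↮ t}` the avoidance event `{s ↮ t, u, v}` is `{code u ≠ 2, code v ≠ 2}`. -/
lemma mem_avoid_t_iff {ω : Config E} (hQ : ω ∈ (connEvent ends s t)ᶜ) :
    ω ∈ CondAvoid.avoidEvent ends s {t, u, v} ↔
      code ends s t ω u ≠ 2 ∧ code ends s t ω v ≠ 2 := by
  have hst : ¬ Conn ends ω s t := hQ
  simp only [CondAvoid.avoidEvent, Set.mem_setOf_eq, Finset.mem_insert, Finset.mem_singleton,
    forall_eq_or_imp, forall_eq, hst, not_false_eq_true, true_and]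
  rw [← code_eq_two_iff ends s t ω u, ← code_eq_two_iff ends s t ω v]

omit [Fintype V] [Fintype E] [DecidableEq E] in
/-- The mirror avoidance event lies in `{s ↮ t}`. -/
lemma avoid_t_subset : CondAvoid.avoidEvent ends s {t, u, v} ⊆ (connEvent ends s t)ᶜ :=
  fun _ h => h t (by simp)

omit [DecidableEq E] in
/-- On `{s ↮ t}`, `{t ↔ x}` is `{code x = 0}`. -/
lemma mem_connEvent_t_iff_code {ω : Config E} (hQ : ω ∈ (connEvent ends s t)ᶜ) (x : V) :
    ω ∈ connEvent ends t x ↔ code ends s t ω x = 0 := by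
  rw [code_eq_zero_iff' hQ]; rfl

omit [DecidableEq E] in
/-- `{u, v ∈ C_t} ∩ {s ↮ t, u, v}` is the grid event `(0, 0)`. -/
lemma ev_tt : connEvent ends t u ∩ connEvent ends t v ∩ CondAvoid.avoidEvent ends s {t, u, v} =
    gridEvent ends s t u v (0, 0) := by
  ext ω
  by_cases hQ : ω ∈ (connEvent ends s t)ᶜ
  · simp only [Set.mem_inter_iff, mem_connEvent_t_iff_code ends s t hQ,
      mem_avoid_t_iff ends s t u v hQ, mem_gridEvent, hQ, and_true]
    generalize code ends s t ω u = a
    generalize code ends s t ω v = b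
    revert a b; decide
  · constructor
    · intro h; exact absurd (avoid_t_subset ends s t u v h.2) hQ
    · intro h; exact absurd h.2 hQ

omit [DecidableEq E] in
/-- `{u ∈ C_t} ∩ {s ↮ t, u, v}` is the union of the grid events `(0, 0)` and `(0, 1)`. -/
lemma ev_tu : connEvent ends t u ∩ CondAvoid.avoidEvent ends s {t, u, v} =
    gridEvent ends s t u v (0, 0) ∪ gridEvent ends s t u v (0, 1) := by
  ext ω
  by_cases hQ : ω ∈ (connEvent ends s t)ᶜ
  · simp only [Set.mem_inter_iff, Set.mem_union, mem_connEvent_t_iff_code ends s t hQ,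
      mem_avoid_t_iff ends s t u v hQ, mem_gridEvent, hQ, and_true]
    generalize code ends s t ω u = a
    generalize code ends s t ω v = b
    revert a b; decide
  · constructor
    · intro h; exact absurd (avoid_t_subset ends s t u v h.2) hQ
    · rintro (h | h) <;> exact absurd h.2 hQ

omit [DecidableEq E] in
/-- `{v ∈ C_t} ∩ {s ↮ t, u, v}` is the union of the grid events `(0, 0)` and `(1, 0)`. -/
lemma ev_tv : connEvent ends t v ∩ CondAvoid.avoidEvent ends s {t, u, v} =
    gridEvent ends s t u v (0, 0) ∪ gridEvent ends s t u v (1, 0) := by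
  ext ω
  by_cases hQ : ω ∈ (connEvent ends s t)ᶜ
  · simp only [Set.mem_inter_iff, Set.mem_union, mem_connEvent_t_iff_code ends s t hQ,
      mem_avoid_t_iff ends s t u v hQ, mem_gridEvent, hQ, and_true]
    generalize code ends s t ω u = a
    generalize code ends s t ω v = b
    revert a b; decide
  · constructor
    · intro h; exact absurd (avoid_t_subset ends s t u v h.2) hQ
    · rintro (h | h) <;> exact absurd h.2 hQ

omit [DecidableEq E] in
/-- `{s ↮ t, u, v}` is the union of the four grid events with both codes in `{0, 1}`. -/
lemma ev_at : CondAvoid.avoidEvent ends s {t, u, v} =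
    ((gridEvent ends s t u v (0, 0) ∪ gridEvent ends s t u v (0, 1)) ∪
      gridEvent ends s t u v (1, 0)) ∪ gridEvent ends s t u v (1, 1) := by
  ext ω
  by_cases hQ : ω ∈ (connEvent ends s t)ᶜ
  · simp only [Set.mem_union, mem_avoid_t_iff ends s t u v hQ, mem_gridEvent, hQ, and_true]
    generalize code ends s t ω u = a
    generalize code ends s t ω v = b
    revert a b; decide
  · constructor
    · intro h; exact absurd (avoid_t_subset ends s t u v h) hQ
    · rintro (((h | h) | h) | h) <;> exact absurd h.2 hQ

/-- `(u, v)` is NOT LINKABLE: no configuration with `s ↮ t` has `u ∈ C_s, v ∈ C_t` or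
`v ∈ C_s, u ∈ C_t`. -/
def NotLinkable : Prop :=
  ∀ ω : Config E, ω ∈ (connEvent ends s t)ᶜ →
    ¬ (Conn ends ω s u ∧ Conn ends ω t v) ∧ ¬ (Conn ends ω s v ∧ Conn ends ω t u)

/-! ### The grid masses -/

variable {u v} (hne : u ≠ v) {p : E → ℝ}
include hne

/-- The grid mass `M a b = P(code u = a, code v = b, s ↮ t)`. -/
lemma mass_eq (a b : Fin 3) :
    BoxUnionPair.pairLaw p ends {u, v} s t (iota u v (a, b)) =
      prob p (gridEvent ends s t u v (a, b)) :=
  pairLaw_iota ends s t hne (a, b)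

omit hne in
/-- The mass of a union of two distinct grid events. -/
lemma prob_union_grid {k k' : Fin 3 × Fin 3} (h : k ≠ k') :
    prob p (gridEvent ends s t u v k ∪ gridEvent ends s t u v k') =
      prob p (gridEvent ends s t u v k) + prob p (gridEvent ends s t u v k') :=
  prob_union_of_disjoint p (gridEvent_disjoint ends s t u v h)

/-- **The central minor (i)** from `pa_given_avoid_conn`. -/
theorem minor_i (hp : IsProbVec p) :
    BoxUnionPair.pairLaw p ends {u, v} s t (iota u v (2, 1)) *
        BoxUnionPair.pairLaw p ends {u, v} s t (iota u v (1, 2)) ≤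
      BoxUnionPair.pairLaw p ends {u, v} s t (iota u v (2, 2)) *
        BoxUnionPair.pairLaw p ends {u, v} s t (iota u v (1, 1)) := by
  have key := CondAvoid.pa_given_avoid_conn p hp ends s t u v
  have hA : prob p (CondAvoid.avoidEvent ends t {s, u, v}) =
      prob p (gridEvent ends s t u v (2, 2)) + prob p (gridEvent ends s t u v (2, 1)) +
        prob p (gridEvent ends s t u v (1, 2)) + prob p (gridEvent ends s t u v (1, 1)) := by
    rw [ev_a, prob_union_of_disjoint p (Set.disjoint_union_left.mpr
        ⟨Set.disjoint_union_left.mpr ⟨gridEvent_disjoint ends s t u v (by decide),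
          gridEvent_disjoint ends s t u v (by decide)⟩,
          gridEvent_disjoint ends s t u v (by decide)⟩),
      prob_union_of_disjoint p (Set.disjoint_union_left.mpr
        ⟨gridEvent_disjoint ends s t u v (by decide), gridEvent_disjoint ends s t u v (by decide)⟩),
      prob_union_of_disjoint p (gridEvent_disjoint ends s t u v (by decide))]
  rw [ev_ss, ev_su, ev_sv, hA, prob_union_grid ends s t (by decide),
    prob_union_grid ends s t (by decide)] at key
  simp only [mass_eq ends s t hne]
  nlinarith [key]

/-- **The central minor (ii)** from `pa_given_avoid_conn` with the roles of `s, t` exchanged. -/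
theorem minor_ii (hp : IsProbVec p) :
    BoxUnionPair.pairLaw p ends {u, v} s t (iota u v (1, 0)) *
        BoxUnionPair.pairLaw p ends {u, v} s t (iota u v (0, 1)) ≤
      BoxUnionPair.pairLaw p ends {u, v} s t (iota u v (1, 1)) *
        BoxUnionPair.pairLaw p ends {u, v} s t (iota u v (0, 0)) := by
  have key := CondAvoid.pa_given_avoid_conn p hp ends t s u v
  have hA : prob p (CondAvoid.avoidEvent ends s {t, u, v}) =
      prob p (gridEvent ends s t u v (0, 0)) + prob p (gridEvent ends s t u v (0, 1)) +
        prob p (gridEvent ends s t u v (1, 0)) + prob p (gridEvent ends s t u v (1, 1)) := by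
    rw [ev_at, prob_union_of_disjoint p (Set.disjoint_union_left.mpr
        ⟨Set.disjoint_union_left.mpr ⟨gridEvent_disjoint ends s t u v (by decide),
          gridEvent_disjoint ends s t u v (by decide)⟩,
          gridEvent_disjoint ends s t u v (by decide)⟩),
      prob_union_of_disjoint p (Set.disjoint_union_left.mpr
        ⟨gridEvent_disjoint ends s t u v (by decide), gridEvent_disjoint ends s t u v (by decide)⟩),
      prob_union_of_disjoint p (gridEvent_disjoint ends s t u v (by decide))]
  rw [ev_tt, ev_tu, ev_tv, hA, prob_union_grid ends s t (by decide),
    prob_union_grid ends s t (by decide)] at key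
  simp only [mass_eq ends s t hne]
  nlinarith [key]

/-! ### Non-linkable pairs -/

omit hne in
/-- The probability of the empty event vanishes. -/
lemma prob_empty' : prob p (∅ : Set (Config E)) = 0 := by
  simp [prob]

/-- Under non-linkability the corner `(2, 0)` carries no mass. -/
lemma mass_two_zero (h : NotLinkable ends s t u v) :
    BoxUnionPair.pairLaw p ends {u, v} s t (iota u v (2, 0)) = 0 := by
  rw [mass_eq ends s t hne]
  have : gridEvent ends s t u v (2, 0) = ∅ := by
    ext ω
    simp only [mem_gridEvent, Set.mem_empty_iff_false, iff_false, not_and]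
    intro h2 h0 hQ
    exact (h ω hQ).1 ⟨(code_eq_two_iff ends s t ω u).mp h2, (code_eq_zero_iff' hQ v).mp h0⟩
  rw [this, prob_empty']

/-- Under non-linkability the corner `(0, 2)` carries no mass. -/
lemma mass_zero_two (h : NotLinkable ends s t u v) :
    BoxUnionPair.pairLaw p ends {u, v} s t (iota u v (0, 2)) = 0 := by
  rw [mass_eq ends s t hne]
  have : gridEvent ends s t u v (0, 2) = ∅ := by
    ext ω
    simp only [mem_gridEvent, Set.mem_empty_iff_false, iff_false, not_and]
    intro h0 h2 hQ
    exact (h ω hQ).2 ⟨(code_eq_two_iff ends s t ω v).mp h2, (code_eq_zero_iff' hQ u).mp h0⟩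
  rw [this, prob_empty']

/-- **(PAIR-TP2), the non-linkable half, in the kernel**: for `u ≠ v` not linkable, the
two-vertex status law `pairLaw p ends {u, v} s t` is log-supermodular on the (Z)-lattice, for
every weight vector. -/
theorem pairLaw_lsm_of_not_linkable (hp : IsProbVec p) (h : NotLinkable ends s t u v)
    (x y : BoxUnionPair.ZLat V) :
    BoxUnionPair.pairLaw p ends {u, v} s t x * BoxUnionPair.pairLaw p ends {u, v} s t y ≤
      BoxUnionPair.pairLaw p ends {u, v} s t (x ⊓ y) *
        BoxUnionPair.pairLaw p ends {u, v} s t (x ⊔ y) := by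
  refine pairLaw_lsm_of_grid ends s t hne hp (fun k k' => ?_) x y
  have key := lsm_of_minors (fun a b => BoxUnionPair.pairLaw p ends {u, v} s t (iota u v (a, b)))
    (fun a b => BoxUnionPair.pairLaw_nonneg ends {u, v} s t hp _)
    (mass_two_zero ends s t hne h) (mass_zero_two ends s t hne h)
    (minor_i ends s t hne hp) (minor_ii ends s t hne hp) k.1 k.2 k'.1 k'.2
  exact key

/-- **The union row for two observed vertices** (kernel): for `u ≠ v` not linkable,
`P(s ↮ t) > 0`, `f g` increasing in the `C_s`-status and decreasing in the `C_t`-status of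
`{u, v}`, and `X, Y ⊆ {u, v}`,
`E[(f(σ) − E[f(σ) | Q]) (g(σ) − E[g(σ) | Q]) · 1_{Q ∩ ({s ↮ X} ∪ {t ↮ Y})}] ≥ 0`. -/
theorem hit_boxUnion_nonneg_of_not_linkable (hp : IsProbVec p) (h : NotLinkable ends s t u v)
    (hQ : 0 < prob p (connEvent ends s t)ᶜ) {f g : Finset V → Finset V → ℝ}
    (hf : ∀ ⦃W W' C C' : Finset V⦄, W ⊆ W' → C' ⊆ C → f W C ≤ f W' C')
    (hg : ∀ ⦃W W' C C' : Finset V⦄, W ⊆ W' → C' ⊆ C → g W C ≤ g W' C')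
    {X Y : Finset V} (hX : X ⊆ {u, v}) (hY : Y ⊆ {u, v}) :
    0 ≤ expect p (((connEvent ends s t)ᶜ ∩ ((hitEvent ends s X)ᶜ ∪ (hitEvent ends t Y)ᶜ)).indicator
      (fun ω =>
        (f (BoxUnionPair.status ends {u, v} s t ω).1
              (OrderDual.ofDual (BoxUnionPair.status ends {u, v} s t ω).2) -
            BoxUnionPair.condMean p ends {u, v} s t (fun k => f k.1 (OrderDual.ofDual k.2))) *
          (g (BoxUnionPair.status ends {u, v} s t ω).1
              (OrderDual.ofDual (BoxUnionPair.status ends {u, v} s t ω).2) -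
            BoxUnionPair.condMean p ends {u, v} s t (fun k => g k.1 (OrderDual.ofDual k.2))))) :=
  BoxUnionPair.hit_boxUnion_nonneg ends {u, v} s t hp
    (pairLaw_lsm_of_not_linkable ends s t hne hp h) hQ hf hg hX hY

end PairTP2

end Summit.Ventures.PercRepro2
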